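import Summits.RiemannHypothesis.RiemannHypothesis.Theorems.TiltedLandingLaw421R3PurseP
import Summits.RiemannHypothesis.RiemannHypothesis.Theorems.TiltedLandingLaw421R3RateBooksQ

/-! # law421 PURSE BOOKS — the RATE BOOKS at a generic depth purse `P` — C4 «kernel desk» rh-idea-6 g29
SUPPORT module for crux `TiltedLandingLaw421` (stmt-RiemannHypothesis-24774), `--supports … --as helper` only: proves no stub, no crux; fully proved (no `sorry`).
Sequel of `…R3PurseP` (generic-purse node `law421P_of_succ_ratePQ : RestSuccBotQ → RestRateBotPQ P → Law421P P`): the books of `…R3RateBooksQ` (`netCostQ`,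
`creditsQ`, the class laws `ClassLawQ` / `CreditLawQ`) are purse-FREE; only the slack and the capital line see the purse. Here: `slackPQ P := P − L_Q 0`
(`slackPQ ratePurseQ = slack0Q` by `rfl`; `slackPQ P = slack0Q + (P − ratePurseQ)`; instances `slackPQ (kappaPurse κ) = slack0Q + (κ − 1)·B`, `slackPQ (voidPurse c)
= slack0Q + c·voidWidth/s`); the generic step / books forms of `RestRateBotPQ P` (with the `k = 0` clause `0 ≤ slackPQ P` explicit — automatic when `P ≥ typedPurse`);
the generic capital `CapitalLawPQ P aF aC aA` (`capitalLawPQ_typed_iff`); ★ `restRateBotPQ_of_threeBooks` and the node by names ★★ `law421P_of_threeBooks :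
RestSuccBotQ → ClassLawQ 𝓕 aF → CreditLawQ (𝓒∖𝓕) aC → ClassLawQ rest aA → CapitalLawPQ P aF aC aA → (INIT_P) → Law421P P`.
So for a restatement with purse `P′ ≥ typedPurse` EVERYTHING in the books chain is reused verbatim; the only new obligation is the capital line with the extra
capital `P′ − typedPurse` (e.g. `(κ − 1)·B` or `c·V/s`). K = bookkeeping about MODEL sockets; which allowances are TRUE is open analysis. RH is NOT proved; 24774 OPEN. -/

namespace RhW08.PurseP

open Complex
open RhIdea6.G17.W07C7 RhIdea6.G17.W07C7.Rev6 RhIdea6.G18.W07C8.Law421BirthS RhIdea6.G19.W07C11.Seam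
open RhIdea6.G20.W07C12.Frac RhIdea6.G20.W07C12.StColP RhW07.C12.FieldSplit RhIdea6.G21.W07C13.TentMax
open RhW07.C14.TwoSided RhW07.C14.Classes RhW07.C14.Lineage RhW07.C14.Booking
open RhW07.C13.Heredity RhIdea6.G22.W07C15pre.Injection RhW07.E3.Cell
open RhW07.E3.Lit
open RhW08.Round1 RhW08.StSwap RhW08.Round2 RhW08.QuadW
open RhW08.SealSwap (PBot)
open RhW08.SealSwapQ

section Slack

/-- the level-0 SLACK at purse `P`: `S_P := P − L_Q 0` (a `Budget`). -/
noncomputable def slackPQ (P : Purse) : Budget := fun η f x₀ s hmax R Hs B =>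
  P f x₀ s hmax R Hs B - rateLHSBotQ η f x₀ s hmax R Hs B 0

/-- (K) at the rate-order typed purse the slack IS the tree's `slack0Q` (definitional). -/
theorem slackPQ_ratePurseQ : slackPQ ratePurseQ = slack0Q := rfl

/-- (K) … and at `typedPurse` (same function). -/
theorem slackPQ_typedPurse : slackPQ typedPurse = slack0Q := by
  rw [← ratePurseQ_eq_typedPurse]; rfl

/-- (K) the slack at purse `P` = the typed slack + the EXTRA CAPITAL `P − ratePurseQ`. -/
theorem slackPQ_eq_slack0Q_add (P : Purse) (η : ℝ) (f : ℂ → ℂ) (x₀ s hmax R Hs : ℝ) (B : ℕ) :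
    slackPQ P η f x₀ s hmax R Hs B = slack0Q η f x₀ s hmax R Hs B + (P f x₀ s hmax R Hs B - ratePurseQ f x₀ s hmax R Hs B) := by
  simp only [slackPQ, slack0Q, ratePurseQ]
  ring

/-- (K) instance: the κ-purse adds `(κ − 1)·B` of capital. -/
theorem slackPQ_kappa (κ : ℝ) (η : ℝ) (f : ℂ → ℂ) (x₀ s hmax R Hs : ℝ) (B : ℕ) :
    slackPQ (kappaPurse κ) η f x₀ s hmax R Hs B = slack0Q η f x₀ s hmax R Hs B + (κ - 1) * B := by
  rw [slackPQ_eq_slack0Q_add]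
  simp only [kappaPurse, ratePurseQ]
  ring

/-- (K) instance: the void purse adds `c·voidWidth/s` of capital. -/
theorem slackPQ_void (c : ℝ) (η : ℝ) (f : ℂ → ℂ) (x₀ s hmax R Hs : ℝ) (B : ℕ) :
    slackPQ (voidPurse c) η f x₀ s hmax R Hs B = slack0Q η f x₀ s hmax R Hs B + c * voidWidth f x₀ R / s := by
  rw [slackPQ_eq_slack0Q_add]
  simp only [voidPurse, ratePurseQ]
  ring

/-- (K) monotonicity of the slack in the purse. -/
theorem slackPQ_mono {P P' : Purse} {η : ℝ} {f : ℂ → ℂ} {x₀ s hmax R Hs : ℝ} {B : ℕ}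
    (h : P f x₀ s hmax R Hs B ≤ P' f x₀ s hmax R Hs B) : slackPQ P η f x₀ s hmax R Hs B ≤ slackPQ P' η f x₀ s hmax R Hs B := by
  simp only [slackPQ]
  linarith

/-- (K) INIT at purse `P` is automatic for `P ≥ typedPurse` on legal frames (`slack0Q_nonneg`, i.e. INIT♯^Q). -/
theorem slackPQ_nonneg_of_typed_le {P : Purse} {η : ℝ} {f : ℂ → ℂ} {x₀ s hmax R Hs : ℝ} {B : ℕ} (hE : EngineHyps5 2 η f x₀ s hmax R Hs B)
    (hP : typedPurse f x₀ s hmax R Hs B ≤ P f x₀ s hmax R Hs B) : 0 ≤ slackPQ P η f x₀ s hmax R Hs B := by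
  have h0 : 0 ≤ slack0Q η f x₀ s hmax R Hs B := slack0Q_nonneg hE
  have h1 : slackPQ typedPurse η f x₀ s hmax R Hs B ≤ slackPQ P η f x₀ s hmax R Hs B := slackPQ_mono hP
  rw [slackPQ_typedPurse] at h1
  linarith

end Slack

section StepForm

/-- (K) STUB 2 at purse `P` read through the account: `RestRateBotPQ P ↔ ∀ legal k, L_Q k ≤ P` (definitional). -/
theorem restRateBotPQ_iff_lhs (P : Purse) : RestRateBotPQ P ↔
    ∀ (η : ℝ) (f : ℂ → ℂ) (x₀ s hmax R Hs : ℝ) (B : ℕ), EngineHyps5 2 η f x₀ s hmax R Hs B →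
      ∀ k : ℕ, rateLHSBotQ η f x₀ s hmax R Hs B k ≤ P f x₀ s hmax R Hs B :=
  Iff.rfl

/-- ★ (K) THE STEP FORM at purse `P`: the `k = 0` clause `L_Q 0 ≤ P` (INIT at `P`) AND after every CHARGED level the account still fits the purse
(the account is frozen across uncharged levels, `rateLHSBotQ_succ_of_not_charged`). -/
theorem restRateBotPQ_iff_step (P : Purse) : RestRateBotPQ P ↔
    ∀ (η : ℝ) (f : ℂ → ℂ) (x₀ s hmax R Hs : ℝ) (B : ℕ), EngineHyps5 2 η f x₀ s hmax R Hs B →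
      rateLHSBotQ η f x₀ s hmax R Hs B 0 ≤ P f x₀ s hmax R Hs B ∧
        ∀ k : ℕ, Charged (PTrkSQ PBot) StTrkDQ ReadyR2 η f x₀ s hmax R Hs B k →
          rateLHSBotQ η f x₀ s hmax R Hs B (k + 1) ≤ P f x₀ s hmax R Hs B := by
  constructor
  · intro h η f x₀ s hmax R Hs B hE
    exact ⟨h η f x₀ s hmax R Hs B hE 0, fun k _ => h η f x₀ s hmax R Hs B hE (k + 1)⟩
  · intro h η f x₀ s hmax R Hs B hE k
    obtain ⟨h0, hstep⟩ := h η f x₀ s hmax R Hs B hE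
    show rateLHSBotQ η f x₀ s hmax R Hs B k ≤ _
    induction k with
    | zero => exact h0
    | succ k ih =>
      by_cases hC : Charged (PTrkSQ PBot) StTrkDQ ReadyR2 η f x₀ s hmax R Hs B k
      · exact hstep k hC
      · rw [rateLHSBotQ_succ_of_not_charged hC]; exact ih

/-- ★★ (K) THE BOOKS at purse `P`: `RestRateBotPQ P` iff INIT at `P` (`0 ≤ S_P`) and after every charged level the net cost is covered by `S_P` plus the credits drawn. -/
theorem restRateBotPQ_iff_books_step (P : Purse) : RestRateBotPQ P ↔
    ∀ (η : ℝ) (f : ℂ → ℂ) (x₀ s hmax R Hs : ℝ) (B : ℕ), EngineHyps5 2 η f x₀ s hmax R Hs B →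
      0 ≤ slackPQ P η f x₀ s hmax R Hs B ∧
        ∀ k : ℕ, Charged (PTrkSQ PBot) StTrkDQ ReadyR2 η f x₀ s hmax R Hs B k →
          netCostQ AllLevelsQ η f x₀ s hmax R Hs B (k + 1)
            ≤ slackPQ P η f x₀ s hmax R Hs B + creditsQ η f x₀ s hmax R Hs B (k + 1) := by
  rw [restRateBotPQ_iff_step]
  refine forall_congr' fun η => forall_congr' fun f => forall_congr' fun x₀ => forall_congr' fun s => forall_congr' fun hmax =>
    forall_congr' fun R => forall_congr' fun Hs => forall_congr' fun B => forall_congr' fun _ => ?_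
  refine and_congr ?_ (forall_congr' fun k => forall_congr' fun _ => ?_)
  · simp only [slackPQ, sub_nonneg]
  · rw [rateLHSBotQ_eq_books η f x₀ s hmax R Hs B (k + 1), netCostQ_all_eq, slackPQ]
    constructor <;> intro h <;> linarith

end StepForm

section Capital

/-- CAPITAL at purse `P`: the three allowances fit in the slack `S_P`. -/
def CapitalLawPQ (P : Purse) (aF aC aA : Budget) : Prop :=
  ∀ (η : ℝ) (f : ℂ → ℂ) (x₀ s hmax R Hs : ℝ) (B : ℕ), EngineHyps5 2 η f x₀ s hmax R Hs B →
    aF η f x₀ s hmax R Hs B + aC η f x₀ s hmax R Hs B + aA η f x₀ s hmax R Hs B ≤ slackPQ P η f x₀ s hmax R Hs B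

/-- (K) at the typed purse it is the tree's `CapitalLawQ`. -/
theorem capitalLawPQ_typed_iff (aF aC aA : Budget) : CapitalLawPQ typedPurse aF aC aA ↔ CapitalLawQ aF aC aA := by
  simp only [CapitalLawPQ, CapitalLawQ, slackPQ_typedPurse]

/-- (K) READ OFF: capital at purse `P` ⟺ the typed capital inequality with the extra capital `P − ratePurseQ` on the right. -/
theorem capitalLawPQ_iff_extra (P : Purse) (aF aC aA : Budget) : CapitalLawPQ P aF aC aA ↔
    ∀ (η : ℝ) (f : ℂ → ℂ) (x₀ s hmax R Hs : ℝ) (B : ℕ), EngineHyps5 2 η f x₀ s hmax R Hs B →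
      aF η f x₀ s hmax R Hs B + aC η f x₀ s hmax R Hs B + aA η f x₀ s hmax R Hs B
        ≤ slack0Q η f x₀ s hmax R Hs B + (P f x₀ s hmax R Hs B - ratePurseQ f x₀ s hmax R Hs B) := by
  simp only [CapitalLawPQ, slackPQ_eq_slack0Q_add]

/-- (K) capital is monotone in the purse. -/
theorem capitalLawPQ_mono {P P' : Purse} {aF aC aA : Budget}
    (hPP' : ∀ (f : ℂ → ℂ) (x₀ s hmax R Hs : ℝ) (B : ℕ), 0 < s → P f x₀ s hmax R Hs B ≤ P' f x₀ s hmax R Hs B)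
    (h : CapitalLawPQ P aF aC aA) : CapitalLawPQ P' aF aC aA := by
  intro η f x₀ s hmax R Hs B hE
  have hs : 0 < s := hE.2.2.2.1
  exact (h η f x₀ s hmax R Hs B hE).trans (slackPQ_mono (hPP' f x₀ s hmax R Hs B hs))

/-- ★★ (K) **THE CLASS SOCKET at purse `P`**: far levels within `aF`, consumption levels (not far) within credits + `aC`, the rest within `aA`, capital
`aF + aC + aA ≤ S_P`, and INIT at `P` ⟹ `RestRateBotPQ P`. (The class laws are the tree's, purse-free.) -/
theorem restRateBotPQ_of_threeBooks {P : Purse} {𝓕 𝓒 : LevelClass} {aF aC aA : Budget}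
    (hF : ClassLawQ 𝓕 aF) (hC : CreditLawQ (diffClass 𝓒 𝓕) aC) (hA : ClassLawQ (restClass 𝓕 𝓒) aA)
    (hcap : CapitalLawPQ P aF aC aA)
    (hinit : ∀ (η : ℝ) (f : ℂ → ℂ) (x₀ s hmax R Hs : ℝ) (B : ℕ), EngineHyps5 2 η f x₀ s hmax R Hs B → 0 ≤ slackPQ P η f x₀ s hmax R Hs B) :
    RestRateBotPQ P := by
  rw [restRateBotPQ_iff_books_step]
  intro η f x₀ s hmax R Hs B hE
  refine ⟨hinit η f x₀ s hmax R Hs B hE, fun k hk => ?_⟩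
  rw [netCostQ_split 𝓕 𝓒]
  have h1 := hF η f x₀ s hmax R Hs B hE k hk
  have h2 := hC η f x₀ s hmax R Hs B hE k hk
  have h3 := hA η f x₀ s hmax R Hs B hE k hk
  have h4 := hcap η f x₀ s hmax R Hs B hE
  linarith

/-- ★★ (K) the same for purses `P ≥ typedPurse` (INIT automatic). -/
theorem restRateBotPQ_of_threeBooks_ge {P : Purse} {𝓕 𝓒 : LevelClass} {aF aC aA : Budget}
    (hP : ∀ (f : ℂ → ℂ) (x₀ s hmax R Hs : ℝ) (B : ℕ), 0 < s → typedPurse f x₀ s hmax R Hs B ≤ P f x₀ s hmax R Hs B)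
    (hF : ClassLawQ 𝓕 aF) (hC : CreditLawQ (diffClass 𝓒 𝓕) aC) (hA : ClassLawQ (restClass 𝓕 𝓒) aA)
    (hcap : CapitalLawPQ P aF aC aA) : RestRateBotPQ P :=
  restRateBotPQ_of_threeBooks hF hC hA hcap
    (fun _ f x₀ s hmax R Hs B hE => slackPQ_nonneg_of_typed_le hE (hP f x₀ s hmax R Hs B hE.2.2.2.1))

/-- ★★★ (K) **THE NODE BY NAMES at purse `P ≥ typedPurse`**: STUB 1 + three books + capital at `P` ⟹ `Law421P P`. -/
theorem law421P_of_threeBooks {P : Purse} {𝓕 𝓒 : LevelClass} {aF aC aA : Budget}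
    (hP : ∀ (f : ℂ → ℂ) (x₀ s hmax R Hs : ℝ) (B : ℕ), 0 < s → typedPurse f x₀ s hmax R Hs B ≤ P f x₀ s hmax R Hs B)
    (hS : RestSuccBotQ) (hF : ClassLawQ 𝓕 aF) (hC : CreditLawQ (diffClass 𝓒 𝓕) aC) (hA : ClassLawQ (restClass 𝓕 𝓒) aA)
    (hcap : CapitalLawPQ P aF aC aA) : Law421P P :=
  law421P_of_succ_ratePQ hS (restRateBotPQ_of_threeBooks_ge hP hF hC hA hcap)

/-- (K) κ-instance by names (`κ ≥ 1`): capital line `aF + aC + aA ≤ slack0Q + (κ − 1)·B`. -/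
theorem law421Kappa_of_threeBooks {κ : ℝ} (hκ : 1 ≤ κ) {𝓕 𝓒 : LevelClass} {aF aC aA : Budget}
    (hS : RestSuccBotQ) (hF : ClassLawQ 𝓕 aF) (hC : CreditLawQ (diffClass 𝓒 𝓕) aC) (hA : ClassLawQ (restClass 𝓕 𝓒) aA)
    (hcap : ∀ (η : ℝ) (f : ℂ → ℂ) (x₀ s hmax R Hs : ℝ) (B : ℕ), EngineHyps5 2 η f x₀ s hmax R Hs B →
      aF η f x₀ s hmax R Hs B + aC η f x₀ s hmax R Hs B + aA η f x₀ s hmax R Hs B ≤ slack0Q η f x₀ s hmax R Hs B + (κ - 1) * B) :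
    Law421P (kappaPurse κ) := by
  refine law421P_of_threeBooks (fun f x₀ s hmax R Hs B _ => typedPurse_le_kappaPurse hκ f x₀ s hmax R Hs B) hS hF hC hA ?_
  intro η f x₀ s hmax R Hs B hE
  rw [slackPQ_kappa]
  exact hcap η f x₀ s hmax R Hs B hE

/-- (K) void-instance by names (`c ≥ 0`): capital line `aF + aC + aA ≤ slack0Q + c·voidWidth/s`. -/
theorem law421Void_of_threeBooks {c : ℝ} (hc : 0 ≤ c) {𝓕 𝓒 : LevelClass} {aF aC aA : Budget}
    (hS : RestSuccBotQ) (hF : ClassLawQ 𝓕 aF) (hC : CreditLawQ (diffClass 𝓒 𝓕) aC) (hA : ClassLawQ (restClass 𝓕 𝓒) aA)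
    (hcap : ∀ (η : ℝ) (f : ℂ → ℂ) (x₀ s hmax R Hs : ℝ) (B : ℕ), EngineHyps5 2 η f x₀ s hmax R Hs B →
      aF η f x₀ s hmax R Hs B + aC η f x₀ s hmax R Hs B + aA η f x₀ s hmax R Hs B ≤ slack0Q η f x₀ s hmax R Hs B + c * voidWidth f x₀ R / s) :
    Law421P (voidPurse c) := by
  refine law421P_of_threeBooks (fun f x₀ s hmax R Hs B hs => typedPurse_le_voidPurse hc f x₀ hs hmax R Hs B) hS hF hC hA ?_
  intro η f x₀ s hmax R Hs B hE
  rw [slackPQ_void]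
  exact hcap η f x₀ s hmax R Hs B hE

end Capital

end RhW08.PurseP
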